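import Summits.BirchSwinnertonDyer.BirchSwinnertonDyer.Theorems.PrintCFramAcDescentThreeOrbitGr
import Summits.BirchSwinnertonDyer.Rank1Residual.X12.O11.RamifiedEllipticUnitMechanismZpThreeGr
import HarnessLib

/-!
# Line «orbit-imc» on the regime-free index law at `3`: (A𝒪)ᴳʳ ∧ (B𝒪)♮ ∧ (PR|IMC)₃♮ ⟹ (R-EU)₃ᵀ class-wide
# — the bottom reading (B𝒪)♮ typed over the Greenberg-form orbit span and ty2's ♮ display, and the
# PROVED consumer the planner asked for (cell `bsd-print-cfram`, D-0131 (2) PRINT tier, prover seat p2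
# gen 3; planner PICK (α) 2026-08-27T21:44:17Z «skeleton orbit-imc on r6 … ty2/p2: please land that
# consumer with (♮); it is the registration prerequisite»; referee R0.28 (X_Gr form CONFIRMED);
# `--supports` the regime-free index-law item once filed, else the T item)

NOTHING is asserted: one `@[conjecture]` `Prop` per curve (plus slice form) and PROVED joins/consumers.

THE CUT (three beyond-print pieces + two named facts, composition PROVED):
* (A𝒪)ᴳʳ `AcMainConjectureOrbitGrAtZpThree W` (p2, `PrintCFramAcDescentThreeOrbitGr.lean`): the
  regime-free `Λ`-level anticyclotomic elliptic-unit main conjecture at `3`, relative to JLK's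
  two-variable identity for `η_E`, over the `End_K(E_K)`-orbit span `Λ_𝒪·z^ac`, against the GREENBERG
  dual `X_Σ = XAc (W_K) 3 κ 𝔭 (badPlacesAwayThree W K) γ` (referee R0.28).
* (B𝒪)♮ `AcBottomReadingGrAtZpThree W` (THIS FILE): the `T = 0` READING with the COMPLETE defect
  display — for every pinned datum `(ι, φ, Ω ≠ 0, 𝓔, D)` satisfying (A𝒪)ᴳʳ's `Λ`-identity for all relaxed
  data `𝒮`, there is `c` with `D.HasBottomIndexExpZp c` such that, `ker r_𝔭` being finite, for every
  admissible away set `T₀` and every `n₀` with `ord₃ f_{X_min}(0) = n₀`, `X_min[T]` finite: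
  `c + log₃ d₀ + log₃ d(T₀) = n₀ + log₃ #X_min[T] + log₃ τ(T₀) + t_cs` — VERBATIM the post-datum part of
  ty2's (IMC)₃♮ `RamifiedCMEllipticUnitIMCAtZpThreeGr W` (p575477; `d₀ = globalControlDefectAtThree`,
  `d(T₀) = controlDefectAtThree`, `τ(T₀) = localKernelProductAtThree`, `t_cs = ord₃
  inertTamagawaProductThree`). Content = the DESCENT of the `Λ`-identity to the bottom layer: Greenberg's
  Euler characteristic for `X_min` (tree), the Pollack–Weston local terms `char X_Σ = char X_min ·
  (3)^{t_cs}` (R0.28), the exact compact relaxed control with its Poitou–Tate cokernel (R0.27 (EC)/(Dual),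
  lit §48 (d)), and the index calculus `[S_rel(K) : tors + 𝒪_𝔭·z(𝟙)]` with `A_tors = E_K(K)[3^∞]`
  (`d₀`) — the bottom dictionary `proj₀(Λ_𝒪·z^ac) = 𝒪_𝔭·z(𝟙)` being PROVED (p574182). Beyond print
  (algebra-shaped; [BKNO] §1.4 «elsewhere»). `@[conjecture]`, nothing asserted.
* (PR|IMC)₃♮ `RamifiedCMBottomClassIndexLawAtZpThreeGr W` (ty2, p575477): Perrin-Riou's law relative to
  the ♮ identity.
* named facts: [JohnsonLeungKings2011] §5.4 (`sec54_…`, supplies `η_E`'s two-variable identity at a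
  frame via p1's `JLKSetting.…_of_isFrameThree`) — GZK only inside ty2's law-from-index converse, not here.

PROVED here: `imcGr_of_sec54_of_orbitGr_of_readingGr` ((A𝒪)ᴳʳ ∧ (B𝒪)♮ ∧ JLK ⟹ (IMC)₃♮ at `W`; the
frame facts `h_K = 1`, `𝔭` unique, `(Φ, η_E)` and the JLK identity discharged as in p1's
`ramifiedCMEllipticUnitIMCAtZpThree_of_sec54_of_specialisation`), `indexAtThreeT_of_sec54_of_orbitGr_of_readingGr_of_lawGr`
((R-EU)₃ᵀ at `W`, via ty2's `ramifiedCMEllipticUnitIndexAtThreeT_of_imcGr_of_indexLawGr`), slice forms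
`AcBottomReadingGrThree`, `forall_imcGr_of_sec54_of_orbitGr_of_readingGr` and the CLASS-WIDE CONSUMER
**`forall_indexAtThreeT_of_orbitImc`** : `sec54 → AcMainConjectureOrbitGrThree → AcBottomReadingGrThree →
(∀ W …, LawGr W) → ∀ W [IsElliptic] [IsGloballyMinimal], HasCM → analyticRank = 1 → CMRamified W 3 →
RamifiedCMEllipticUnitIndexAtThreeT W` — the conclusion is the planner's r6 text `AnticyclotomicIndexLawThree`
VERBATIM (binder order `HasCM → analyticRank → CMRamified`), so the skeleton «orbit-imc» is
`r6_of stub_sec54 stub_orbitGr stub_readingGr stub_lawGr := forall_indexAtThreeT_of_orbitImc …`.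

HONEST LIMITS: nothing asserted or closed; (A𝒪)ᴳʳ, (B𝒪)♮, (PR|IMC)₃♮ are beyond print at `3`; the line
does not claim the converse. «beyond-print theorem»: NO.

References: [BurungaleKobayashiNakamuraOta2026] arXiv:2608.06879v1 §3.2.2, Prop. 3.7, Thm. 3.14, §1.4
(claim; preprint); [PollackWeston2011] §3 Prop. 3.7; [GreenbergLNM1716] §3–§4; [JohnsonLeungKings2011]
§5.4; [PerrinRiou1993AIF] §3.3; tree p570848, p573036, p574182, p575481 (p2), p575477 (ty2), p558613 (p1
`JLKSetting`); cell STATUS planner 21:44:17Z, ty2 21:40:30Z/21:51:37Z, REF R0.27/R0.28.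
-/

-- the summit namespace `Summit.BirchSwinnertonDyer.BirchSwinnertonDyer` repeats the problem name by design (D-0017)
set_option linter.dupNamespace false

noncomputable section

open scoped Classical

open WeierstrassCurve NumberField IsDedekindDomain Field Module PowerSeries
  Literature.NumberTheory.GaloisRepresentations
  Literature.NumberTheory.EllipticCurves
  Literature.NumberTheory.EllipticCurves.GreenbergSelmer
  Literature.NumberTheory.EllipticCurves.Rank1Residual
  Literature.NumberTheory.EllipticCurves.Rank1Residual.Typed
  Literature.NumberTheory.EllipticCurves.BurungaleKobayashiNakamuraOta2026
  Literature.NumberTheory.EllipticCurves.KellerYin2024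
  Literature.NumberTheory.ComplexMultiplication.EllipticUnits
  Literature.NumberTheory.ComplexMultiplication.EllipticUnits.JohnsonLeungKings2011
  Literature.NumberTheory.NumberFields
  Summit.BirchSwinnertonDyer.Rank1Residual
  Summit.BirchSwinnertonDyer.Rank1Residual.Additive
  Summit.BirchSwinnertonDyer.Rank1Residual.X11b
  Summit.BirchSwinnertonDyer.Rank1Residual.X12.O11
  Summit.BirchSwinnertonDyer.BirchSwinnertonDyer.Theorems
  Summit.BirchSwinnertonDyer.BirchSwinnertonDyer.Theorems.PrintCFram.AcDescentThreeSplit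
  Summit.BirchSwinnertonDyer.BirchSwinnertonDyer.Theorems.PrintCFram.AcDescentThreeOrbit

namespace Summit.BirchSwinnertonDyer.BirchSwinnertonDyer.Theorems.PrintCFram.OrbitImc

variable (W : WeierstrassCurve ℚ) [W.IsElliptic] [W.IsGloballyMinimal]

/-! ## §1 (B𝒪)♮ — the bottom reading with the complete defect display, over the Greenberg orbit form -/

/-- **(B𝒪)♮ The BOTTOM-LAYER (`T = 0`) READING at the ramified `3` with the COMPLETE defect display, over
the Greenberg-form orbit span** (`@[conjecture]`, NOTHING asserted): at every `3`-frame of analytic rank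
one, for every anticyclotomic `κ` with generator `γ` and EVERY pinned datum `(ι, φ, Ω ≠ 0, 𝓔, D)`
(`L(φ, s) = L(W, s)`) satisfying (A𝒪)ᴳʳ's `Λ`-identity for all relaxed data `𝒮` (torsion of
`𝒮.S ⧸ endOrbitSpan 𝒮 D.z` and of `X_Σ = XAc (W_K) 3 κ 𝔭 (badPlacesAwayThree W K) γ`, equal
`Λ`-characteristic ideals), there is `c` with `D.HasBottomIndexExpZp c` such that — `ker r_𝔭` finite —
for every finite `T₀` of places `v ∤ 3` with (Av)₃ off `T₀` and every `n₀` with `ord₃ f_{X_min}(0) = n₀`,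
`X_min[T]` finite: `c + log₃ d₀ + log₃ d(T₀) = n₀ + log₃ #X_min[T] + log₃ τ(T₀) + t_cs` (VERBATIM the
post-datum part of ty2's `RamifiedCMEllipticUnitIMCAtZpThreeGr W`). The DESCENT obligation: Euler
characteristic, Pollack–Weston local terms, exact relaxed compact control + Poitou–Tate cokernel, index
calculus with `A_tors = E_K(K)[3^∞]` (module docstring). Beyond print. OPEN.
[cite: GreenbergLNM1716, §4 Lemma 4.2 and Prop. 4.13 (Euler characteristic; the defect terms; shape only)]
[cite: PollackWeston2011, §3 Lemma 3.4 and Prop. 3.7 (the local terms at the completely split places; shape only)]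
[cite: BurungaleKobayashiNakamuraOta2026, §3.2.2, Thm. 3.14 and §1.4 (arXiv:2608.06879v1 pp. 8, 18, 24) (claim; preprint; shape only)] -/
@[conjecture] def AcBottomReadingGrAtZpThree : Prop :=
  ∀ (K : Type) [Field K] [NumberField K] (𝔭 : HeightOneSpectrum (𝓞 K))
    (W' : WeierstrassCurve ℚ) [W'.IsElliptic] [W'.IsGloballyMinimal] (C : VariableChange ℚ),
    IsFrameThree W K 𝔭 W' C → W.analyticRank = 1 →
    ∀ (κ : ZpExtension K 3), κ.IsAnticyclotomic →
      ∀ (γ : absoluteGaloisGroup K) [Fact (κ.IsTopGenerator γ)],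
        ∀ (ι : PadicAlgCl 3 ≃+* ℂ) (φ : HeckeCharacter K) (Ω : ℂ) (𝓔 : AcDualExpSystem W 3 K 𝔭 κ ι)
          (D : EllipticUnitClassData W 3 K 𝔭 κ γ ι φ Ω 𝓔),
          Ω ≠ 0 → (∀ s : ℂ, 3 / 2 < s.re → heckeLFunction φ s = W.LSeries s) →
          (∀ (𝒮 : LambdaAdicRelaxedSelmerData (W.baseChange K) κ γ 𝔭),
            Module.IsTorsion (IwasawaAlgebra 3) (𝒮.S ⧸ endOrbitSpan 𝒮 D.z) ∧
            Module.IsTorsion (IwasawaAlgebra 3)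
              (Castella2018.AcSelmer.XAc (W.baseChange K) 3 κ 𝔭 (badPlacesAwayThree W K) γ) ∧
            Module.charIdeal (IwasawaAlgebra 3) (𝒮.S ⧸ endOrbitSpan 𝒮 D.z) =
              Module.charIdeal (IwasawaAlgebra 3)
                (Castella2018.AcSelmer.XAc (W.baseChange K) 3 κ 𝔭 (badPlacesAwayThree W K) γ)) →
          ∃ c : ℕ, D.HasBottomIndexExpZp c ∧
            (Finite (X11b.AcSelmer.localKer κ.kerSubgroup ((W.baseChange K).geomPrimaryTorsion 3) 𝔭) →
              ∀ (T₀ : Finset (HeightOneSpectrum (𝓞 K))), (∀ v ∈ T₀, ((3 : ℕ) : 𝓞 K) ∉ v.asIdeal) →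
              (∀ v : HeightOneSpectrum (𝓞 K), v ∉ T₀ → ((3 : ℕ) : 𝓞 K) ∉ v.asIdeal →
                v.asIdeal.ramificationIdx (𝓞 ℚ) = 1 → v.asIdeal.inertiaDeg (𝓞 ℚ) = 1 →
                (W.baseChange K).HasGoodReductionAt v ∨
                  ∀ R : ((W.baseChange K).baseChange (v.adicCompletion K)).toAffine.Point,
                    (3 : ℕ) • R = 0 → R = 0) →
              ∀ (n₀ : ℕ), X11b.AcSelmer.XAc.HasCharValuationAt (W.baseChange K) 3 κ 𝔭 ∅ γ n₀ →
                Finite {x : X11b.AcSelmer.XAc (W.baseChange K) 3 κ 𝔭 ∅ γ //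
                  (PowerSeries.X : IwasawaAlgebra 3) • x = 0} →
                (c : ℤ) + padicValNat 3 (globalControlDefectAtThree W K κ) +
                    padicValNat 3 (controlDefectAtThree W K 𝔭 κ T₀) =
                  (n₀ : ℤ) + padicValNat 3 (Nat.card {x : X11b.AcSelmer.XAc (W.baseChange K) 3 κ 𝔭 ∅ γ //
                      (PowerSeries.X : IwasawaAlgebra 3) • x = 0}) +
                    padicValNat 3 (localKernelProductAtThree W 𝔭 κ T₀) +
                    padicValNat 3 (inertTamagawaProductThree W K))

/-! ## §2 The joins at a curve `W` -/

variable {W}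

/-- **JLK's named fact ∧ (A𝒪)ᴳʳ ∧ (B𝒪)♮ ⟹ (IMC)₃♮ at `W`** (PROVED): at a `3`-frame, p1's
`JLKSetting.charIdeal_classGroup_eq_unitIndex_of_sec54_residualChar_of_isFrameThree` supplies the stable
line `Φ`, the residual character `η_E` with its defining properties and — granted the fact — JLK's
two-variable equality for it; `h_K = 1` (`LeafInterface.classNumber_eq_one`), `𝔭` unique
(`IsFrameThree.eq_of_mem`); (A𝒪)ᴳʳ then yields the pinned datum with the `Λ`-identity over the orbit span
against `X_Σ`, and (B𝒪)♮ reads it at `T = 0` with the complete display. CONDITIONAL on `h54` and the two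
pieces. [cite: JohnsonLeungKings2011, §5.4 (arXiv:0804.2828 p0016:L19–26)]
[cite: BurungaleKobayashiNakamuraOta2026, Thm. 3.14 (arXiv:2608.06879v1 p. 24) (claim; preprint)] -/
theorem imcGr_of_sec54_of_orbitGr_of_readingGr (h54 : sec54_charIdeal_classGroup_eq_unitIndex)
    (hA : AcMainConjectureOrbitGrAtZpThree W) (hB : AcBottomReadingGrAtZpThree W) :
    RamifiedCMEllipticUnitIMCAtZpThreeGr W := by
  intro K _ _ 𝔭 W' _ _ C hF hr κ hκ γ _
  obtain ⟨hCM, hram, hK, hdK, h𝔭, -⟩ := id hF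
  obtain ⟨Φ, η, ⟨hcard, hle, hstab, hpair, hlift, hker⟩, hJLK⟩ :=
    JLKSetting.charIdeal_classGroup_eq_unitIndex_of_sec54_residualChar_of_isFrameThree h54 hF
  have hh : NumberField.classNumber K = 1 := LeafInterface.classNumber_eq_one W hCM hK hdK
  have huniq : ∀ w : HeightOneSpectrum (𝓞 K), ((3 : ℕ) : 𝓞 K) ∈ w.asIdeal → w = 𝔭 :=
    fun w hw ↦ hF.eq_of_mem hw
  obtain ⟨ι, φ, Ω, 𝓔, D, hΩ, hL, hIMC⟩ :=
    hA K 𝔭 W' C hF hr hh huniq Φ η hcard hle hstab hpair hlift hker hJLK κ hκ γ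
  obtain ⟨c, hc, hread⟩ := hB K 𝔭 W' C hF hr κ hκ γ ι φ Ω 𝓔 D hΩ hL hIMC
  exact ⟨ι, φ, Ω, 𝓔, D, c, hΩ, hL, hc, hread⟩

/-- **JLK ∧ (A𝒪)ᴳʳ ∧ (B𝒪)♮ ∧ (PR|IMC)₃♮ ⟹ (R-EU)₃ᵀ at `W`** (PROVED: the previous join composed with
ty2's `ramifiedCMEllipticUnitIndexAtThreeT_of_imcGr_of_indexLawGr` — the displayed `c`, `τ(T₀)`, `t_cs`
cancel). [cite: JohnsonLeungKings2011, §5.4 (arXiv:0804.2828 p0016:L19–26)]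
[cite: GreenbergLNM1716, §4 Prop. 4.13 (the defect terms)] -/
theorem indexAtThreeT_of_sec54_of_orbitGr_of_readingGr_of_lawGr
    (h54 : sec54_charIdeal_classGroup_eq_unitIndex)
    (hA : AcMainConjectureOrbitGrAtZpThree W) (hB : AcBottomReadingGrAtZpThree W)
    (hlaw : RamifiedCMBottomClassIndexLawAtZpThreeGr W) :
    RamifiedCMEllipticUnitIndexAtThreeT W :=
  ramifiedCMEllipticUnitIndexAtThreeT_of_imcGr_of_indexLawGr
    (imcGr_of_sec54_of_orbitGr_of_readingGr h54 hA hB) hlaw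

/-! ## §3 Slice forms and the class-wide consumer (the planner's registration prerequisite) -/

/-- **(B𝒪)♮ on the whole `p = 3` slice** (binders of the route's `p = 3` items). `@[conjecture]`, nothing
asserted. [cite: GreenbergLNM1716, §4 Lemma 4.2 (shape only)] -/
@[conjecture] def AcBottomReadingGrThree : Prop :=
  ∀ (W : WeierstrassCurve ℚ) [W.IsElliptic] [W.IsGloballyMinimal],
    W.HasCM → CMRamified W 3 → W.analyticRank = 1 → AcBottomReadingGrAtZpThree W

/-- **(IMC)₃♮ class-wide from JLK ∧ (A𝒪)ᴳʳ-slice ∧ (B𝒪)♮-slice** (PROVED) — exactly the hypothesis `h1`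
of ty2's class-wide seams `forall_indexAtThreeT_of_forall_imcGr_of_forall_indexLawGr` (p575477) and of
its route-level companion. [cite: JohnsonLeungKings2011, §5.4 (arXiv:0804.2828 p0016:L19–26)]
[cite: BurungaleKobayashiNakamuraOta2026, Thm. 3.14 (arXiv:2608.06879v1 p. 24) (claim; preprint)] -/
theorem forall_imcGr_of_sec54_of_orbitGr_of_readingGr (h54 : sec54_charIdeal_classGroup_eq_unitIndex)
    (hA : AcMainConjectureOrbitGrThree) (hB : AcBottomReadingGrThree) :
    ∀ (W : WeierstrassCurve ℚ) [W.IsElliptic] [W.IsGloballyMinimal],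
      W.HasCM → CMRamified W 3 → W.analyticRank = 1 → RamifiedCMEllipticUnitIMCAtZpThreeGr W :=
  fun W _ _ hCM hram hr ↦
    imcGr_of_sec54_of_orbitGr_of_readingGr h54 (hA W hCM hram hr) (hB W hCM hram hr)

/-- **THE CONSUMER of line «orbit-imc»: JLK's named fact ∧ (A𝒪)ᴳʳ-slice ∧ (B𝒪)♮-slice ∧
(PR|IMC)₃♮-slice ⟹ the regime-free index law (R-EU)₃ᵀ on the whole `p = 3` slice** — conclusion
VERBATIM the planner's r6 text (`HasCM → analyticRank = 1 → CMRamified W 3 →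
RamifiedCMEllipticUnitIndexAtThreeT W`). PROVED (the joins above, curve by curve).
[cite: JohnsonLeungKings2011, §5.4 (arXiv:0804.2828 p0016:L19–26)] [cite: GreenbergLNM1716, §4 Prop. 4.13] -/
theorem forall_indexAtThreeT_of_orbitImc (h54 : sec54_charIdeal_classGroup_eq_unitIndex)
    (hA : AcMainConjectureOrbitGrThree) (hB : AcBottomReadingGrThree)
    (hlaw : ∀ (W : WeierstrassCurve ℚ) [W.IsElliptic] [W.IsGloballyMinimal],
      W.HasCM → CMRamified W 3 → W.analyticRank = 1 → RamifiedCMBottomClassIndexLawAtZpThreeGr W) :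
    ∀ (W : WeierstrassCurve ℚ) [W.IsElliptic] [W.IsGloballyMinimal],
      W.HasCM → W.analyticRank = 1 → CMRamified W 3 → RamifiedCMEllipticUnitIndexAtThreeT W :=
  fun W _ _ hCM hr hram ↦
    indexAtThreeT_of_sec54_of_orbitGr_of_readingGr_of_lawGr h54 (hA W hCM hram hr) (hB W hCM hram hr)
      (hlaw W hCM hram hr)

/-- **The same consumer with ty2's GZK-guarded law hypothesis** (the shape of `h2` in
`forall_indexAtThreeT_of_forall_imcGr_of_forall_indexLawGr`): JLK ∧ (A𝒪)ᴳʳ-slice ∧ (B𝒪)♮-slice ∧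
(GZK → (PR|IMC)₃♮-slice) ∧ GZK ⟹ (R-EU)₃ᵀ on the slice. PROVED (ty2's seam ∘ the class-wide (IMC)₃♮).
[cite: GrossZagier1986, Thm. I.(7.3)] [cite: Kolyvagin1990, Thm. A] -/
theorem forall_indexAtThreeT_of_orbitImc_of_GZK (h54 : sec54_charIdeal_classGroup_eq_unitIndex)
    (hA : AcMainConjectureOrbitGrThree) (hB : AcBottomReadingGrThree)
    (hlaw : rank_eq_analyticRank_of_analyticRank_le_one →
      ∀ (W : WeierstrassCurve ℚ) [W.IsElliptic] [W.IsGloballyMinimal],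
      W.HasCM → CMRamified W 3 → W.analyticRank = 1 → RamifiedCMBottomClassIndexLawAtZpThreeGr W)
    (hGZK : rank_eq_analyticRank_of_analyticRank_le_one) :
    ∀ (W : WeierstrassCurve ℚ) [W.IsElliptic] [W.IsGloballyMinimal],
      W.HasCM → W.analyticRank = 1 → CMRamified W 3 → RamifiedCMEllipticUnitIndexAtThreeT W :=
  forall_indexAtThreeT_of_forall_imcGr_of_forall_indexLawGr
    (forall_imcGr_of_sec54_of_orbitGr_of_readingGr h54 hA hB) hlaw hGZK

end Summit.BirchSwinnertonDyer.BirchSwinnertonDyer.Theorems.PrintCFram.OrbitImc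

end
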